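import Literature.Probability.Percolation.QuadLowestCrossingProofs
import Literature.Topology.PlaneTopology.PlusCrossing
import HarnessLib

/-!
# Self-duality of joint scaling limits, part A ("not both"): an open crossing and a wider,
# shorter dual-open crossing cannot coexist
# (crux `SubseqCardy`, stmt-CriticalPhenomena-5768, line `registered`, lead c4)

Route `CardyAnchoredRigidity` (decl shared verbatim with `CardyLocalRigidity`), sub-problem
`CardyFormulaZ2`.  Step W3 of the structure theory of joint sequential limits is the general
SELF-DUALITY `g R + g R⁺ = 1` of every joint sequential limit `g` of the bond-`ℤ²` crossing
probabilities on every conformal rectangle `R` (`R⁺` the conjugate rectangle, crossed in the other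
direction).  At mesh level it has two halves: "at least one" of the primal crossing of the quad and
the dual crossing of the conjugate quad occurs (dual chains; a neighbouring file), and — this
file — the mesh-level "NOT BOTH":

* `selfDual_chart_notBoth` — for a chart `Φ : ℂ ≃ₜ ℂ`, a mesh `δ > 0` and `a ≤ -1`, `1 ≤ b`,
  `-1 ≤ c ≤ d ≤ 1`, an open crossing of the model square between `Φ(bottom)` and `Φ(top)`
  (`ChartCrossed (swapC.trans Φ) (-1) 1 (-1) 1 δ ω`, a left-right crossing in the swapped chart)
  and a dual-open left-right crossing of the WIDER (`a ≤ -1`, `1 ≤ b`) and SHORTER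
  (`-1 ≤ c ≤ d ≤ 1`) rectangle `[a,b] × [c,d]`, for the dual configuration `dualConfig ω` drawn on
  `δℤ² + δ(½,½)` (chart `Φ - dualShift δ`), cannot coexist.

Proof.  The swap `swapC '' K` of the primal witness `K ⊆ [-1,1]²` is a continuum in the strip
`-1 ≤ re ≤ 1` meeting `{im = -1}` and `{im = 1}`; the dual witness `H ⊆ [a,b] × [c,d]` is a
continuum in the band `c ≤ im ≤ d` meeting `{re = a}` (`a ≤ -1`) and `{re = b}` (`1 ≤ b`).  The two
are in plus position in the `Φ`-chart, so they meet
(`Literature.Topology.PlaneTopology.inter_nonempty_of_plus`), at a chart point `z` with `Φ z` on a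
drawn open edge of `ω` and `Φ z - δ(½,½)` on a drawn open edge of `dualConfig ω`, which
`Literature.Probability.Percolation.SSContinuity.not_mem_openEdgeUnion_dualConfig_sub` forbids
(an open edge does not meet an open dual edge).  This is "Part 2" of
`Literature.Probability.Percolation.SSContinuity.chartCrossed_dualConfig_of_topMove`, in the
plus-position form.

References: B. Bollobás, O. Riordan, *Percolation* (2006), Ch. 7 Claim 19 p. 192 (a horizontal and a
vertical crossing of a rectangle meet), Ch. 5 p. 111 (open edges miss open dual edges);
O. Schramm, S. Smirnov, Ann. Probab. 39 (2011) §1.3.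
-/

noncomputable section

namespace Summit.CriticalPhenomena.CardyFormulaZ2.Cruxes.SubseqCardy.Birth

open Set Complex
open Literature.Probability.LatticeModels (Site)
open Literature.Probability.Percolation (BondConfig dualConfig openEdgeUnion)
open Literature.Probability.Percolation.SSContinuity
open Literature.Topology.PlaneTopology (inter_nonempty_of_plus)

/-- **Self-duality at mesh level, part A ("not both").**  For a chart `Φ`, a mesh `δ > 0` and
`a ≤ -1`, `1 ≤ b`, `-1 ≤ c ≤ d ≤ 1`: an open crossing of the model square `[-1,1]²` between
`Φ(bottom)` and `Φ(top)` (a left-right crossing in the swapped chart `swapC.trans Φ`) and a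
dual-open left-right crossing of `Φ([a,b] × [c,d]) - δ(½,½)` for `dualConfig ω` cannot coexist:
the swapped primal continuum (strip `-1 ≤ re ≤ 1`, from `im = -1` to `im = 1`) and the dual
continuum (band `c ≤ im ≤ d`, from `re = a` to `re = b`) are in plus position, so they meet
(`inter_nonempty_of_plus`), at a point drawn both on an open edge and, shifted by `-δ(½,½)`, on an
open dual edge (`not_mem_openEdgeUnion_dualConfig_sub`).
[cite: BollobasRiordan2006, Ch. 7 Claim 19 p. 192] -/
theorem selfDual_chart_notBoth : ∀ (Φ : ℂ ≃ₜ ℂ) (δ : ℝ), 0 < δ → ∀ (a b c d : ℝ), a ≤ -1 → 1 ≤ b → -1 ≤ c → c ≤ d → d ≤ 1 → ∀ ω : Literature.Probability.Percolation.BondConfig (Literature.Probability.LatticeModels.Site 2), Literature.Probability.Percolation.SSContinuity.ChartCrossed (Literature.Probability.Percolation.SSContinuity.swapC.trans Φ) (-1) 1 (-1) 1 δ ω → Literature.Probability.Percolation.SSContinuity.ChartCrossed (Φ.trans (Homeomorph.addRight (-Literature.Probability.Percolation.SSContinuity.dualShift δ))) a b c d δ (Literature.Probability.Percolation.dualConfig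 ω) → False := by
  intro Φ δ hδ a b c d ha hb hc hcd hd ω
  rintro ⟨K, hKsub, hKc, hKconn, hKO, ⟨pa, hpa, hpare⟩, ⟨pb, hpb, hpbre⟩⟩
    ⟨H, hHsub, hHc, hHconn, hHO, ⟨qa, hqa, hqare⟩, ⟨qb, hqb, hqbre⟩⟩
  -- the swapped primal witness `swapC '' K` (strip `-1 ≤ re ≤ 1`, from `im = -1` to `im = 1`)
  -- and the dual witness `H` (band `c ≤ im ≤ d`, from `re = a ≤ -1` to `re = b ≥ 1`) are in plus
  -- position in the chart, so they meet
  obtain ⟨_, ⟨k, hk, rfl⟩, hkH⟩ := inter_nonempty_of_plus (V := swapC '' K) (H := H)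
      (a := -1) (b := 1) (c := c) (d := d) (by norm_num) hcd
      (hKc.image swapC.continuous) (hKconn.isPreconnected.image _ swapC.continuous.continuousOn)
      (by rintro _ ⟨u, hu, rfl⟩; exact (hKsub hu).2)
      ⟨_, ⟨pa, hpa, rfl⟩, by rw [swapC_im, hpare]; exact hc⟩
      ⟨_, ⟨pb, hpb, rfl⟩, by rw [swapC_im, hpbre]; exact hd⟩
      hHc hHconn.isPreconnected (fun z hz => (hHsub hz).2)
      ⟨qa, hqa, by rw [hqare]; exact ha⟩ ⟨qb, hqb, by rw [hqbre]; exact hb⟩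
  -- at the meeting point `Φ (swapC k)` lies on a drawn open edge of `ω`, and
  -- `Φ (swapC k) - δ(½,½)` on a drawn open edge of `dualConfig ω`
  have h₁ : Φ (swapC k) ∈ openEdgeUnion δ ω := hKO k hk
  have h₂ : Φ (swapC k) - dualShift δ ∈ openEdgeUnion δ (dualConfig ω) := by
    rw [sub_eq_add_neg]
    exact hHO _ hkH
  exact not_mem_openEdgeUnion_dualConfig_sub hδ h₁ h₂

end Summit.CriticalPhenomena.CardyFormulaZ2.Cruxes.SubseqCardy.Birth
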